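import Summits.BirchSwinnertonDyer.Rank1Residual.P2.ShuZhaiCMBaseTransport
import Summits.BirchSwinnertonDyer.Rank1Residual.P2.ShuZhaiOneFortyFourCurve
import Literature.NumberTheory.EllipticCurves.ShuZhai2021.Base144a1
import HarnessLib

/-!
# Cell `bsd-print-cf2` (D-0131 (2) PRINT TIER, leaf CornerF @ `p = 2`) — the Shu–Zhai 2021 family at the
# SECOND `j = 0` base `144a1 : y² = x³ − 1`: `ord_{s=1} L = 1 ∧ BSD(W, 2)` BY NAME on every globally
# minimal `W` `ℚ`-isogenous to `144a1^{(−pM)} ≅ y² = x³ + (pM)³` (`p ≡ 23 (mod 24)` prime, `M = ∏Q`,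
# `q ≡ 5 (mod 12)`, `M ≡ 1 (mod 24)`) — THEOREMS ONLY; `cornerFTwo_shuZhaiOneFortyFour_item` is the consequent
# of route `PrintCf2` aside `InertShuZhaiOneFortyFourOfFactsPlus` (stmt-BirchSwinnertonDyer-21260) literally

HONEST FRAMING (cell `bsd-print-cf2`, run/shared/lean/pub/bsd-print-cf2/; the partition leaf «CornerF @ `2`» =
`Summit.BirchSwinnertonDyer.WAllCornerFTwo` is OPEN AS A CLASS). THEOREMS ONLY: no definition, no named fact, no
published theorem restated. This is the CONSUMER of ty2 g2's setting file `P2/ShuZhaiOneFortyFourCurve.lean`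
(`thm12Setting_curve144a1`, admissibility ⟺ `q ≡ 5 (mod 12)`, the `ℚ(√−p)` / `ℚ(√M)` splitting conditions for
`p ≡ 23 (mod 24)` / `M ≡ 1 (mod 24)`, odd Manin constant by ARS06) through p2 g3's base-generic transport
`P2/ShuZhaiCMBaseTransport.lean` (any CM base of the Shu–Zhai setting: base certificate = row C8), on the pattern
of p3's `P2/ShuZhaiThirtySix{Slices,IsogenyClass,Table}.lean` (the `36a1` family `y² = x³ − (pM)³`, aside 20597,
CLOSED). Print (lit g4, DOSSIER §17): Shu–Zhai, J. reine angew. Math. 775 (2021) Thm 1.2 / Thm 1.4 / Thm 4.10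
at the optimal CM base `E₀ = 144a1 = [0,0,0,0,−1] = 36a1^{(−1)}` (conductor `144 = 2⁴3²`; Cremona Table 1:
optimal, `E₀(ℚ) ≅ ℤ/2`; Table 4: `L(E₀,1)/Ω = 1/2`, so `f([0]) = (0,0) ∉ 2E₀(ℚ)` — tree fact
`ShuZhai2021.base144a1_optimal_cuspZero`, p551268, model `ShuZhai2021.curve144a1 = [0,3,0,3,0]`): for every
prime `p ≡ 23 (mod 24)` and every finite set `Q` of primes `q ≡ 5 (mod 12)` with `M = ∏ q ≡ 1 (mod 24)`, the
twist `E₀^{(−pM)} ≅ y² = x³ + (pM)³` has `ord_{s=1} L = rank = 1`, `Ш` finite of odd order,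
`ord₂(L′/ΩR) = #Q`, and satisfies BSD(·,2), transported from `BSD(E₀,2)` = CM rank zero, row C8
(Burungale–Flach 2024 / Rubin; `L(E₀,1) ≠ 0` is itself Thm 1.2 at `r = 0`).

§1 the base pair (`r_an(144a1) = 0 ∧ BSD(144a1, ℓ)` at every prime); §2 the rank-one twists on MODELS
(general `Q` admissible + `ℚ(√M)`-condition; `r = 0`; explicit congruences) and Thm 4.10's unconditional
content (`Ш` odd, `ord₂ = #Q`); §3 the `ℚ`-ISOGENY CLASS (Cassels BY NAME); §4 the same with the two display
hypotheses (`Dt`/`IsOptimalDatum`, `CuspZeroNotInTwice`) replaced by the table fact `base144a1_optimal_cuspZero`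
and the odd Manin constant by ARS06 — ENTIRELY BY NAME; §5 the slices in the binder shape of route `PrintCf2`
aside `InertShuZhaiOneFortyFourOfFactsPlus` (stmt-BirchSwinnertonDyer-21260) — `cornerFTwo_shuZhaiOneFortyFour_item`
is LITERALLY its consequent, so the aside closes by destructuring its antecedent
(`Theorems/PrintCf2InertShuZhaiOneFortyFourOfFactsPlus.lean`). The membership clauses are INLINED here exactly
as in the route file; the named predicates `P2.IsShuZhaiOneFortyFourTwist` / `P2.IsIsogenousToShuZhaiOneFortyFourTwist`,
the placement (CM, `2` INERT, BAD at `2` — slice `WAllCornerFTwoInertBad`, crux 20671) and the W-ALL leaf /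
residual bookkeeping live in `WAll/TargetCMTwoInertShuZhaiOneFortyFour.lean` (seat p4).

Binders displayed, nothing else: `thm12_ranks_of_twists` (SZ Thm 1.2), `thm14_twoPartBSD_of_twists` (Thm 1.4),
`thm410_twoAdicValuations_of_twists` (Thm 4.10), `bsdTriple_of_hasCM_of_L_one_ne_zero` (row C8),
`hasEntireLFunction_rat` (modularity), `bsdRHS_eq_of_isIsogenous` (Cassels),
`AgasheRibetStein2006.cremona_abs_maninConstant_eq_one_of_level_le` (ARS06), `base144a1_optimal_cuspZero`
(TABLE-COMPOSITE) — the conjuncts of aside 21260's antecedent. Seat p4's own strategy sentence («2-adic CM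
Iwasawa road …») is booked as beyond-print NO with its named residual (MEMO-p4-IWASAWA2.md, crux 20368 + the
non-split classes); this file is the cell's idle by-name consumer task (STATUS 2026-08-27T17:59:44Z TAKES).
beyond-print theorem: NO (Shu–Zhai's printed theorems read on the leaf). PARTITION: the sub-cell
«`y² = x³ + (pM)³`» of crux 20671 (inert, bad at `2`) from NO PRINT to IN PRINT by name.

References: [ShuZhai2021] Thm 1.2, Thm 1.4, Thm 4.10, Def 1.1 (arXiv:2102.11808 chunks p0003 L17–L45, p0013
L14–L26); [Cremona1997] Table 1 (N = 144, A1), Table 4 (row 144 A); [AgasheRibetStein2006] Thm 2.6;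
[BurungaleFlach2024] Thm 1.1, Cor 2; [MilneADT2006] Thm I.7.3 (Cassels); [Miller2011LMS] Def 1.1; tree files
`P2/ShuZhaiOneFortyFourCurve.lean` (ty2 g2), `P2/ShuZhaiCMBaseTransport.lean` (p2 g3, p550830),
`P2/ShuZhaiThirtySixAdmissible.lean` (p3: `prod_qStar_eq_of_forall_mod_twelve`),
`Literature/…/ShuZhai2021/Base144a1.lean` (lit g4, p551268); cell dossier DOSSIER.md §17.
-/

noncomputable section

open scoped Classical

open WeierstrassCurve NumberField Literature.NumberTheory.EllipticCurves
  Literature.NumberTheory.EllipticCurves.Rank1Residual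
  Literature.NumberTheory.EllipticCurves.ModularForms
  Literature.NumberTheory.EllipticCurves.ShuZhai2021
  Summit.BirchSwinnertonDyer.Rank1Residual

set_option autoImplicit false

namespace Summit.BirchSwinnertonDyer.Rank1Residual.P2

/-! ## §1 The base `144a1`: analytic rank `0` (Thm 1.2 at `r = 0`) and `BSD(144a1, ℓ)` at every prime (row C8) -/

/-- **The base pair: `ord_{s=1} L(144a1, s) = 0` and `BSD(144a1, ℓ)` at EVERY prime `ℓ`** — Shu–Zhai
Thm 1.2 at `r = 0` (`h12`, setting at `p = 23`, `Q = ∅`) and row C8 (`hCM` = Burungale–Flach / Rubin for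
CM curves with `L(E,1) ≠ 0`, modularity `hmod`), via `analyticRank_eq_zero_and_bsdp_of_shuZhai_of_hasCM`;
display hypotheses `Dt`, `hopt`, `hcusp` as printed (Cremona Tables 1/4 for `144a1`).
[cite: ShuZhai2021, Thm. 1.2 (arXiv:2102.11808 chunk p0003 L24–L32)] [cite: BurungaleFlach2024, Thm. 1.1 and Cor. 2]
[cite: Cremona1997, Table 1 (N = 144, A1) and Table 4 (144 A)] [cite: Miller2011LMS, Def. 1.1] -/
theorem analyticRank_eq_zero_and_bsdp_curve144a1 (h12 : thm12_ranks_of_twists)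
    (hCM : bsdTriple_of_hasCM_of_L_one_ne_zero) (hmod : hasEntireLFunction_rat)
    (Dt : ModularParametrizationData curve144a1 (curve144a1.conductorNorm ℤ))
    (hopt : IsOptimalDatum curve144a1 Dt) (hcusp : CuspZeroNotInTwice curve144a1 Dt) (ℓ : ℕ) [Fact ℓ.Prime] :
    curve144a1.analyticRank = 0 ∧ BSDp curve144a1 ℓ :=
  analyticRank_eq_zero_and_bsdp_of_shuZhai_of_hasCM h12 hCM hmod
    (thm12Setting_curve144a1 Dt hopt hcusp (p := 23) (by norm_num) (by norm_num) (Q := ∅)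
      (fun q hq => absurd hq (Finset.notMem_empty q))) hasCM_curve144a1 ℓ

/-! ## §2 The rank-ONE twists `144a1^{(−pM)} ≅ y² = x³ + (pM)³`: `ord_{s=1} L = 1 ∧ BSD(·, 2)` on models -/

/-- **`ord_{s=1} L(W,s) = 1 ∧ BSD(W, 2)` for every globally minimal model `W` of `144a1^{(−pM)}`**, `p ≡ 23
(mod 24)` prime, `Q` admissible primes `≠ p` with every prime of `2N` split in `ℚ(√M)`, `M = ∏ q*` — Shu–Zhai
Thm 1.2 (`h12`) + Thm 1.4 (`h14`) with the CM base certificate discharged by row C8 (`hCM`), modularity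
(`hmod`), odd Manin constant `hc`; display hypotheses `Dt hopt hcusp` as printed.
[cite: ShuZhai2021, Thm. 1.2 and Thm. 1.4 (arXiv:2102.11808 chunk p0003 L24–L45)]
[cite: BurungaleFlach2024, Cor. 2] [cite: Miller2011LMS, Def. 1.1] -/
theorem analyticRank_eq_one_and_bsdp_two_of_twist_curve144a1 (h12 : thm12_ranks_of_twists)
    (h14 : thm14_twoPartBSD_of_twists) (hCM : bsdTriple_of_hasCM_of_L_one_ne_zero)
    (hmod : hasEntireLFunction_rat)
    (Dt : ModularParametrizationData curve144a1 (curve144a1.conductorNorm ℤ))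
    (hopt : IsOptimalDatum curve144a1 Dt) (hcusp : CuspZeroNotInTwice curve144a1 Dt) (hc : ¬ (2 : ℤ) ∣ Dt.c)
    {p : ℕ} (hp : p.Prime) (h24 : p % 24 = 23)
    {Q : Finset ℕ} (hQ : ∀ q ∈ Q, IsAdmissible curve144a1 (⟨0, -6, 0, -3, 0⟩ : WeierstrassCurve ℚ) q ∧ q ≠ p)
    (hQM : AllPrimesSplitInSqrt (2 * curve144a1.conductorNorm ℤ) (∏ q ∈ Q, qStar q))
    (W : WeierstrassCurve ℚ) [W.IsElliptic] [W.IsGloballyMinimal]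
    (hW : ∃ C : VariableChange ℚ,
      C • curve144a1.quadraticTwist ((-(p : ℤ) * ∏ q ∈ Q, qStar q : ℤ) : ℚ) = W) :
    W.analyticRank = 1 ∧ BSDp W 2 :=
  analyticRank_eq_one_and_bsdp_two_of_rankOneTwist_of_hasCM h12 h14 hCM hmod
    (thm12Setting_curve144a1 Dt hopt hcusp hp h24 hQ) hasCM_curve144a1 hc
    (allPrimesSplitInSqrt_two_mul_conductorNorm_curve144a1 hp h24) hQM W hW

/-- **The `r = 0` sub-family `144a1^{(−p)} ≅ y² = x³ + p³`, `p ≡ 23 (mod 24)` prime** — no admissibility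
datum: `ord_{s=1} L(W,s) = 1 ∧ BSD(W, 2)` for every globally minimal model `W`.
[cite: ShuZhai2021, Thm. 1.2 and Thm. 1.4 (r = 0)] [cite: BurungaleFlach2024, Cor. 2] -/
theorem analyticRank_eq_one_and_bsdp_two_of_twist_curve144a1_prime (h12 : thm12_ranks_of_twists)
    (h14 : thm14_twoPartBSD_of_twists) (hCM : bsdTriple_of_hasCM_of_L_one_ne_zero)
    (hmod : hasEntireLFunction_rat)
    (Dt : ModularParametrizationData curve144a1 (curve144a1.conductorNorm ℤ))
    (hopt : IsOptimalDatum curve144a1 Dt) (hcusp : CuspZeroNotInTwice curve144a1 Dt) (hc : ¬ (2 : ℤ) ∣ Dt.c)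
    {p : ℕ} (hp : p.Prime) (h24 : p % 24 = 23)
    (W : WeierstrassCurve ℚ) [W.IsElliptic] [W.IsGloballyMinimal]
    (hW : ∃ C : VariableChange ℚ, C • curve144a1.quadraticTwist (-(p : ℚ)) = W) :
    W.analyticRank = 1 ∧ BSDp W 2 := by
  refine analyticRank_eq_one_and_bsdp_two_of_twist_curve144a1 h12 h14 hCM hmod Dt hopt hcusp hc hp h24
    (Q := ∅) (fun q hq => absurd hq (Finset.notMem_empty q)) (allPrimesSplitInSqrt_prod_empty _) W ?_
  simpa using hW

/-- **The EXPLICIT two-parameter family**: `p ≡ 23 (mod 24)` prime, `Q` any finite set of primes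
`q ≡ 5 (mod 12)` with `M = ∏ q ≡ 1 (mod 24)`, twist `144a1^{(−pM)} ≅ y² = x³ + (pM)³`: `ord_{s=1} L(W,s) = 1
∧ BSD(W, 2)` for every globally minimal model `W` (admissibility and the `ℚ(√M)`-condition discharged by
the congruences). [cite: ShuZhai2021, Thm. 1.2, Thm. 1.4 and Def. 1.1] [cite: BurungaleFlach2024, Cor. 2] -/
theorem analyticRank_eq_one_and_bsdp_two_of_twist_curve144a1_explicit (h12 : thm12_ranks_of_twists)
    (h14 : thm14_twoPartBSD_of_twists) (hCM : bsdTriple_of_hasCM_of_L_one_ne_zero)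
    (hmod : hasEntireLFunction_rat)
    (Dt : ModularParametrizationData curve144a1 (curve144a1.conductorNorm ℤ))
    (hopt : IsOptimalDatum curve144a1 Dt) (hcusp : CuspZeroNotInTwice curve144a1 Dt) (hc : ¬ (2 : ℤ) ∣ Dt.c)
    {p : ℕ} (hp : p.Prime) (h24 : p % 24 = 23)
    {Q : Finset ℕ} (hQ : ∀ q ∈ Q, q.Prime ∧ q % 12 = 5) (hM : (∏ q ∈ Q, q) % 24 = 1)
    (W : WeierstrassCurve ℚ) [W.IsElliptic] [W.IsGloballyMinimal]
    (hW : ∃ C : VariableChange ℚ, C • curve144a1.quadraticTwist (-((p * ∏ q ∈ Q, q : ℕ) : ℚ)) = W) :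
    W.analyticRank = 1 ∧ BSDp W 2 := by
  refine analyticRank_eq_one_and_bsdp_two_of_twist_curve144a1 h12 h14 hCM hmod Dt hopt hcusp hc hp h24
    (admissible_curve144a1_of_forall_mod_twelve h24 hQ)
    (allPrimesSplitInSqrt_two_mul_conductorNorm_prod_curve144a1 hQ hM) W ?_
  rw [prod_qStar_eq_of_forall_mod_twelve hQ]
  push_cast at hW ⊢
  simpa [neg_mul] using hW

/-- **Shu–Zhai Thm 4.10 on the explicit family, UNCONDITIONAL content** (no base certificate): every
globally minimal model `W` of `144a1^{(−pM)}` (explicit congruences) has `ord_{s=1} L = rank = 1`, `Ш(W)`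
finite of ODD order, and `L′(W,1) = x · Ω · R` with `ord₂ x = #Q` — given the display hypotheses and the
odd Manin constant. [cite: ShuZhai2021, Thm. 4.10 (arXiv:2102.11808 chunk p0013 L14–L26)] -/
theorem sha_odd_and_ordTwo_of_twist_curve144a1_explicit (h410 : thm410_twoAdicValuations_of_twists)
    (Dt : ModularParametrizationData curve144a1 (curve144a1.conductorNorm ℤ))
    (hopt : IsOptimalDatum curve144a1 Dt) (hcusp : CuspZeroNotInTwice curve144a1 Dt) (hc : ¬ (2 : ℤ) ∣ Dt.c)
    {p : ℕ} (hp : p.Prime) (h24 : p % 24 = 23)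
    {Q : Finset ℕ} (hQ : ∀ q ∈ Q, q.Prime ∧ q % 12 = 5) (hM : (∏ q ∈ Q, q) % 24 = 1)
    (W : WeierstrassCurve ℚ) [W.IsElliptic] [W.IsGloballyMinimal]
    (hW : ∃ C : VariableChange ℚ, C • curve144a1.quadraticTwist (-((p * ∏ q ∈ Q, q : ℕ) : ℚ)) = W) :
    (W.analyticRank = 1 ∧ W.mordellWeilRank = 1) ∧ (Finite W.sha ∧ Odd (Nat.card W.sha)) ∧
      ∃ x : ℚ, W.leadingLCoeff = (x : ℂ) * (W.realPeriodRat : ℂ) * (W.regulator : ℂ) ∧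
        padicValRat 2 x = (Q.card : ℤ) := by
  refine sha_odd_and_ordTwo_of_rankOneTwist h410
    (thm12Setting_curve144a1 Dt hopt hcusp hp h24 (admissible_curve144a1_of_forall_mod_twelve h24 hQ))
    (allPrimesSplitInSqrt_two_mul_conductorNorm_prod_curve144a1 hQ hM) (by omega) hc W ?_
  rw [prod_qStar_eq_of_forall_mod_twelve hQ]
  push_cast at hW ⊢
  simpa [neg_mul] using hW

/-! ## §3 The `ℚ`-ISOGENY CLASS of the rank-one twist (Cassels' invariance BY NAME) -/

/-- **`ord_{s=1} L = 1 ∧ BSD(W, 2)` for every globally minimal `W` `ℚ`-ISOGENOUS to `144a1^{(−pM)}`** (explicit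
congruences), granted in addition Cassels' isogeny invariance (`hCassels` = `bsdRHS_eq_of_isIsogenous`) —
`analyticRank_eq_one_and_bsdp_two_of_isIsogenous_rankOneTwist_of_hasCM`.
[cite: ShuZhai2021, Thm. 1.2 and Thm. 1.4] [cite: MilneADT2006, Thm. I.7.3] [cite: BurungaleFlach2024, Cor. 2]
[cite: Miller2011LMS, Def. 1.1] -/
theorem analyticRank_eq_one_and_bsdp_two_of_isIsogenous_twist_curve144a1_explicit
    (hCassels : bsdRHS_eq_of_isIsogenous) (h12 : thm12_ranks_of_twists)
    (h14 : thm14_twoPartBSD_of_twists) (hCM : bsdTriple_of_hasCM_of_L_one_ne_zero)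
    (hmod : hasEntireLFunction_rat)
    (Dt : ModularParametrizationData curve144a1 (curve144a1.conductorNorm ℤ))
    (hopt : IsOptimalDatum curve144a1 Dt) (hcusp : CuspZeroNotInTwice curve144a1 Dt) (hc : ¬ (2 : ℤ) ∣ Dt.c)
    {p : ℕ} (hp : p.Prime) (h24 : p % 24 = 23)
    {Q : Finset ℕ} (hQ : ∀ q ∈ Q, q.Prime ∧ q % 12 = 5) (hM : (∏ q ∈ Q, q) % 24 = 1)
    (W : WeierstrassCurve ℚ) [W.IsElliptic] [W.IsGloballyMinimal]
    (hiso : IsIsogenous W (curve144a1.quadraticTwist (-((p * ∏ q ∈ Q, q : ℕ) : ℚ)))) :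
    W.analyticRank = 1 ∧ BSDp W 2 := by
  refine analyticRank_eq_one_and_bsdp_two_of_isIsogenous_rankOneTwist_of_hasCM hCassels h12 h14 hCM hmod
    (thm12Setting_curve144a1 Dt hopt hcusp hp h24 (admissible_curve144a1_of_forall_mod_twelve h24 hQ))
    hasCM_curve144a1 hc (allPrimesSplitInSqrt_two_mul_conductorNorm_curve144a1 hp h24)
    (allPrimesSplitInSqrt_two_mul_conductorNorm_prod_curve144a1 hQ hM) W ?_
  rw [prod_qStar_eq_of_forall_mod_twelve hQ]
  push_cast
  simpa [neg_mul] using hiso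

/-! ## §4 The slice BY NAME — the display hypotheses replaced by the table fact `base144a1_optimal_cuspZero`

(Theorems only: the membership predicates `P2.IsShuZhaiOneFortyFourTwist` / `P2.IsIsogenousToShuZhaiOneFortyFourTwist`
live in `WAll/TargetCMTwoInertShuZhaiOneFortyFour.lean`; here the membership clauses are INLINED, literally as in
route `PrintCf2` aside 21260, so that every statement below is definitionally the predicate form.) -/

/-- **The base pair BY NAME**: `ord_{s=1} L(144a1,s) = 0 ∧ BSD(144a1, ℓ)` for every prime `ℓ`, granted
`h12 hCM hmod` and the TABLE-COMPOSITE base fact `hbase` (its instance and datum unpacked; the `NeZero` witness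
is a proof, any two agree). [cite: ShuZhai2021, Thm. 1.2] [cite: Cremona1997, Table 1 (N = 144, A1) and Table 4 (144 A)]
[cite: BurungaleFlach2024, Thm. 1.1 and Cor. 2] -/
theorem analyticRank_eq_zero_and_bsdp_curve144a1_byName (h12 : thm12_ranks_of_twists)
    (hCM : bsdTriple_of_hasCM_of_L_one_ne_zero) (hmod : hasEntireLFunction_rat)
    (hbase : base144a1_optimal_cuspZero) (ℓ : ℕ) [Fact ℓ.Prime] :
    curve144a1.analyticRank = 0 ∧ BSDp curve144a1 ℓ := by
  obtain ⟨_, Dt, hopt, hcusp⟩ := hbase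
  exact analyticRank_eq_zero_and_bsdp_curve144a1 h12 hCM hmod Dt hopt hcusp ℓ

/-- **`ord_{s=1} L(W,s) = 1 ∧ BSD(W, 2)` on the MODELS of the explicit Shu–Zhai family of `144a1`, ENTIRELY BY
NAME**: Shu–Zhai Thm 1.2 (`h12`), Thm 1.4 (`h14`), row C8 (`hCM`), modularity (`hmod`), Agashe–Ribet–Stein 2006
Thm 2.6 (`hARS`) and the base fact `base144a1_optimal_cuspZero` (`hbase`: Cremona Table 1 N = 144 A1 optimal,
Table 4 `L/Ω = 1/2` ⇒ `f([0]) = (0,0) ∉ 2E(ℚ)`). Membership clause = `P2.IsShuZhaiOneFortyFourTwist W` unfolded.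
[cite: ShuZhai2021, Thm. 1.2 and Thm. 1.4] [cite: Cremona1997, Table 1 (N = 144, A1) and Table 4 (144 A)]
[cite: AgasheRibetStein2006, Thm. 2.6] [cite: BurungaleFlach2024, Thm. 1.1 and Cor. 2] [cite: Miller2011LMS, Def. 1.1] -/
theorem analyticRank_eq_one_and_bsdp_two_of_smul_twist_curve144a1_byName (h12 : thm12_ranks_of_twists)
    (h14 : thm14_twoPartBSD_of_twists) (hCM : bsdTriple_of_hasCM_of_L_one_ne_zero)
    (hmod : hasEntireLFunction_rat)
    (hARS : AgasheRibetStein2006.cremona_abs_maninConstant_eq_one_of_level_le)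
    (hbase : base144a1_optimal_cuspZero) (W : WeierstrassCurve ℚ) [W.IsElliptic] [W.IsGloballyMinimal]
    (hW : ∃ (p : ℕ) (Q : Finset ℕ) (C : VariableChange ℚ), p.Prime ∧ p % 24 = 23 ∧
      (∀ q ∈ Q, q.Prime ∧ q % 12 = 5) ∧ (∏ q ∈ Q, q) % 24 = 1 ∧
      C • curve144a1.quadraticTwist (-((p * ∏ q ∈ Q, q : ℕ) : ℚ)) = W) :
    W.analyticRank = 1 ∧ BSDp W 2 := by
  obtain ⟨_, Dt, hopt, hcusp⟩ := hbase
  obtain ⟨p, Q, C, hp, h24, hQ, hM, hC⟩ := hW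
  exact analyticRank_eq_one_and_bsdp_two_of_twist_curve144a1_explicit h12 h14 hCM hmod Dt hopt hcusp
    (not_two_dvd_c_of_isOptimalDatum_curve144a1 hARS Dt hopt) hp h24 hQ hM W ⟨C, hC⟩

/-- **`ord_{s=1} L = 1 ∧ BSD(W,2)` on the ISOGENY CLASSES of the explicit twists of `144a1`, ENTIRELY BY NAME**
(binders `hCassels h12 h14 hCM hmod hARS hbase`; membership clause = `P2.IsIsogenousToShuZhaiOneFortyFourTwist W`
unfolded = the clause of aside 21260). [cite: ShuZhai2021, Thm. 1.2 and Thm. 1.4] [cite: MilneADT2006, Thm. I.7.3]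
[cite: Cremona1997, Table 1 (N = 144, A1) and Table 4 (144 A)] [cite: AgasheRibetStein2006, Thm. 2.6]
[cite: BurungaleFlach2024, Cor. 2] [cite: Miller2011LMS, Def. 1.1] -/
theorem analyticRank_eq_one_and_bsdp_two_of_isIsogenous_twist_curve144a1_byName
    (hCassels : bsdRHS_eq_of_isIsogenous) (h12 : thm12_ranks_of_twists) (h14 : thm14_twoPartBSD_of_twists)
    (hCM : bsdTriple_of_hasCM_of_L_one_ne_zero) (hmod : hasEntireLFunction_rat)
    (hARS : AgasheRibetStein2006.cremona_abs_maninConstant_eq_one_of_level_le)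
    (hbase : base144a1_optimal_cuspZero) (W : WeierstrassCurve ℚ) [W.IsElliptic] [W.IsGloballyMinimal]
    (hW : ∃ (p : ℕ) (Q : Finset ℕ), p.Prime ∧ p % 24 = 23 ∧ (∀ q ∈ Q, q.Prime ∧ q % 12 = 5) ∧
      (∏ q ∈ Q, q) % 24 = 1 ∧ IsIsogenous W (curve144a1.quadraticTwist (-((p * ∏ q ∈ Q, q : ℕ) : ℚ)))) :
    W.analyticRank = 1 ∧ BSDp W 2 := by
  obtain ⟨_, Dt, hopt, hcusp⟩ := hbase
  obtain ⟨p, Q, hp, h24, hQ, hM, hiso⟩ := hW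
  exact analyticRank_eq_one_and_bsdp_two_of_isIsogenous_twist_curve144a1_explicit hCassels h12 h14 hCM hmod
    Dt hopt hcusp (not_two_dvd_c_of_isOptimalDatum_curve144a1 hARS Dt hopt) hp h24 hQ hM W hiso

/-- **Ш odd and `ord₂(L′/(Ω R)) = #Q` on the models of the explicit family, BY NAME** (Thm 4.10 `h410`, ARS06
`hARS`, the base fact `hbase`). [cite: ShuZhai2021, Thm. 4.10] [cite: Cremona1997, Table 1 (N = 144, A1) and Table 4 (144 A)]
[cite: AgasheRibetStein2006, Thm. 2.6] -/
theorem sha_odd_and_ordTwo_of_smul_twist_curve144a1_byName (h410 : thm410_twoAdicValuations_of_twists)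
    (hARS : AgasheRibetStein2006.cremona_abs_maninConstant_eq_one_of_level_le)
    (hbase : base144a1_optimal_cuspZero) {p : ℕ} (hp : p.Prime) (h24 : p % 24 = 23)
    {Q : Finset ℕ} (hQ : ∀ q ∈ Q, q.Prime ∧ q % 12 = 5) (hM : (∏ q ∈ Q, q) % 24 = 1)
    (W : WeierstrassCurve ℚ) [W.IsElliptic] [W.IsGloballyMinimal]
    (hW : ∃ C : VariableChange ℚ, C • curve144a1.quadraticTwist (-((p * ∏ q ∈ Q, q : ℕ) : ℚ)) = W) :
    (W.analyticRank = 1 ∧ W.mordellWeilRank = 1) ∧ (Finite W.sha ∧ Odd (Nat.card W.sha)) ∧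
      ∃ x : ℚ, W.leadingLCoeff = (x : ℂ) * (W.realPeriodRat : ℂ) * (W.regulator : ℂ) ∧
        padicValRat 2 x = (Q.card : ℤ) := by
  obtain ⟨_, Dt, hopt, hcusp⟩ := hbase
  exact sha_odd_and_ordTwo_of_twist_curve144a1_explicit h410 Dt hopt hcusp
    (not_two_dvd_c_of_isOptimalDatum_curve144a1 hARS Dt hopt) hp h24 hQ hM W hW

/-! ## §5 The slices in the binder shape of route `PrintCf2` aside 21260 (LITERALLY its consequent) -/

/-- **SLICE SZ144 (models) BY NAME, in the binder shape of aside 21260 restricted to MODELS** (`… → ∀ W, W.HasCM →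
W.analyticRank = 1 → CMInert W 2 → ⟨W is a ℚ-model of 144a1^{(−p∏q)}⟩ → BSDp W 2`; the three slice hypotheses are
implied by membership and not used). beyond-print: NO. [cite: ShuZhai2021, Thm. 1.2 and Thm. 1.4]
[cite: Cremona1997, Table 1 (N = 144, A1) and Table 4 (144 A)] [cite: AgasheRibetStein2006, Thm. 2.6]
[cite: BurungaleFlach2024, Cor. 2] [cite: Miller2011LMS, Def. 1.1] -/
theorem cornerFTwo_shuZhaiOneFortyFour_models (h12 : thm12_ranks_of_twists) (h14 : thm14_twoPartBSD_of_twists)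
    (hCM : bsdTriple_of_hasCM_of_L_one_ne_zero) (hmod : hasEntireLFunction_rat)
    (hARS : AgasheRibetStein2006.cremona_abs_maninConstant_eq_one_of_level_le)
    (hbase : base144a1_optimal_cuspZero) :
    ∀ (W : WeierstrassCurve ℚ) [W.IsElliptic] [W.IsGloballyMinimal], W.HasCM → W.analyticRank = 1 →
      CMInert W 2 → (∃ (p : ℕ) (Q : Finset ℕ) (C : VariableChange ℚ), p.Prime ∧ p % 24 = 23 ∧
        (∀ q ∈ Q, q.Prime ∧ q % 12 = 5) ∧ (∏ q ∈ Q, q) % 24 = 1 ∧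
        C • curve144a1.quadraticTwist (-((p * ∏ q ∈ Q, q : ℕ) : ℚ)) = W) → BSDp W 2 :=
  fun W _ _ _ _ _ hW =>
    (analyticRank_eq_one_and_bsdp_two_of_smul_twist_curve144a1_byName h12 h14 hCM hmod hARS hbase W hW).2

/-- **SLICE SZ144-ISOGENY-CLASS BY NAME = the consequent of aside 21260 `InertShuZhaiOneFortyFourOfFactsPlus`
LITERALLY** (`… → ∀ W, W.HasCM → W.analyticRank = 1 → CMInert W 2 → ⟨W ℚ-isogenous to 144a1^{(−p∏q)}⟩ →
BSDp W 2`), closed granted `hCassels h12 h14 hCM hmod hARS hbase` — seven conjuncts of the aside's antecedent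
(𝔅_inert (3) Cassels, (6) Thm 1.2, (7) Thm 1.4, (4) row C8, (2) modularity; ARS06; the base fact) — so the
item's closer is `fun ⟨⟨_, hmod, hCas, hCM, _, h12, h14, _⟩, hARS, hbase⟩ ↦ cornerFTwo_shuZhaiOneFortyFour_item
hCas h12 h14 hCM hmod hARS hbase`. beyond-print: NO. [cite: ShuZhai2021, Thm. 1.2 and Thm. 1.4]
[cite: MilneADT2006, Thm. I.7.3] [cite: Cremona1997, Table 1 (N = 144, A1) and Table 4 (144 A)]
[cite: AgasheRibetStein2006, Thm. 2.6] [cite: BurungaleFlach2024, Cor. 2] [cite: Miller2011LMS, Def. 1.1] -/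
theorem cornerFTwo_shuZhaiOneFortyFour_item (hCassels : bsdRHS_eq_of_isIsogenous)
    (h12 : thm12_ranks_of_twists) (h14 : thm14_twoPartBSD_of_twists)
    (hCM : bsdTriple_of_hasCM_of_L_one_ne_zero) (hmod : hasEntireLFunction_rat)
    (hARS : AgasheRibetStein2006.cremona_abs_maninConstant_eq_one_of_level_le)
    (hbase : base144a1_optimal_cuspZero) :
    ∀ (W : WeierstrassCurve ℚ) [W.IsElliptic] [W.IsGloballyMinimal], W.HasCM → W.analyticRank = 1 →
      CMInert W 2 → (∃ (p : ℕ) (Q : Finset ℕ), p.Prime ∧ p % 24 = 23 ∧ (∀ q ∈ Q, q.Prime ∧ q % 12 = 5) ∧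
        (∏ q ∈ Q, q) % 24 = 1 ∧ IsIsogenous W (curve144a1.quadraticTwist (-((p * ∏ q ∈ Q, q : ℕ) : ℚ)))) →
      BSDp W 2 :=
  fun W _ _ _ _ _ hW =>
    (analyticRank_eq_one_and_bsdp_two_of_isIsogenous_twist_curve144a1_byName hCassels h12 h14 hCM hmod hARS
      hbase W hW).2

end Summit.BirchSwinnertonDyer.Rank1Residual.P2

end
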